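import Mathlib
import Literature.NumberTheory.LFunctions.Zhang2022.AppendixALemma83PowSum
import HarnessLib

/-!
# Zhang (2022), Appendix A part 1 (proof of Lemma 8.3): the local Euler factors in closed form
# and the bound at the primes `q ∣ dh` on `σ > 9/10` (GAP-LEDGER G-d55-2) — kernel-checked

Topic `Literature/NumberTheory/LFunctions/Zhang2022` (Landau–Siegel audit tree; verdict-neutral).
Y. Zhang, *Discrete mean estimates and the Landau–Siegel zero*, arXiv:2211.02515v1 (2022)
[Zhang2022LandauSiegel], Appendix A pp. 101–103 and §8 Lemma 8.3 (ii) (tex L2385: "`|𝒰_j(d,r;s)| <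
c∏_{q∣dr}(1 + cq^{−σ})` for `σ > 9/10`"), **an unrefereed manuscript under adjudication**.

The printed proof bounds the local factor `𝔱_j(d,h,s;q)` only for `(q,dh) = 1` (`= 1 + O(q^{−9/5})`)
and evaluates it for `q ∣ dh` only near `s = 1` ((A.2), (A.3)); Lemma 8.3 (ii) needs a bound for
`q ∣ dh` on the whole half-plane `σ > 9/10`, which is not in print (campaign GAP-LEDGER row G-d55-2,
class not-in-print / in-cone). This file PROVES it, via closed forms:

* `hasSum_kappa_prime_pow_mul_pow` — the generating function of `κ` at a prime:
  `Σ_{r≥0} κ(q^r)Z^r = (1−Z)/((1−q^{−β₁}Z)(1−q^{−β₂}Z)(1−q^{−β₃}Z))` for `|Z| < 1`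
  (`κ = n^{−β₁} ∗ n^{−β₂} ∗ n^{−β₃} ∗ μ`; Cauchy products of geometric series);
* `frakt_eq_of_dvd_right` — **Case 2** (`q ∣ h`): `𝔱_j(d,h,s;q) = 1/(1 − χ(q)q^{−s−β_j})`;
* `frakt_eq_of_dvd_left` — **Case 3** (`q ∣ d`, `q ∤ h`):
  `𝔱_j(d,h,s;q) = (1 − χ(q)q^{−s}q^{1−β_j}/(q−1))/(1 − χ(q)q^{−s−β_j})`;
* `norm_frakt_le_of_dvd` / `stepA_u007_dvd` — **for `q ∣ dh` and `σ > 9/10`: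
  `‖𝔱_j(d,h,s;q)‖ ≤ 1 + 12q^{−σ}`** (all `D`, no Assumption (A) needed; stated also in the campaign's
  `ForAllLarge` frame exactly as the GAP-LEDGER row G-d55-2 asks).

Nothing here bears on Theorems 1–2 of the manuscript.

## References

* Y. Zhang, arXiv:2211.02515v1 (2022), §8 Lemma 8.3, Appendix A pp. 101–103. [cite: Zhang2022LandauSiegel, App. A]
-/

noncomputable section

open Complex Real ComplexConjugate Finset

namespace Literature.NumberTheory.LFunctions.Zhang2022.Lemma83

open Literature.NumberTheory.LFunctions.Zhang2022
open Literature.NumberTheory.LFunctions.Zhang2022.Skeleton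
open Literature.NumberTheory.LFunctions.Zhang2022.MeanSquareMajorant
open Literature.NumberTheory.LFunctions.Zhang2022.Typed.AppendixA1

/-! ## `powI` at prime powers -/

/-- `(q^k)^{−ib} = (q^{−ib})^k`. [folklore] -/
private theorem powI_prime_pow_eq_pow (b : ℝ) {q : ℕ} (hq : 0 < q) (k : ℕ) :
    powI b (q ^ k) = (powI b q) ^ k := by
  induction k with
  | zero => rw [pow_zero, pow_zero]; exact (isMultiplicative_powI b).map_one
  | succ k ih =>
      rw [pow_succ, pow_succ, ← ih, powI_apply_of_ne_zero b (mul_ne_zero (pow_ne_zero k hq.ne') hq.ne'),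
        powI_apply_of_ne_zero b (pow_ne_zero k hq.ne'), powI_apply_of_ne_zero b hq.ne', Nat.cast_mul,
        Complex.natCast_mul_natCast_cpow]

/-- `‖q^{−ib}‖ = 1`. [folklore] -/
private theorem norm_powI_eq_one (b : ℝ) {q : ℕ} (hq : 0 < q) : ‖powI b q‖ = 1 := norm_powI_of_pos b hq

/-! ## The generating function of `κ` at a prime -/

/-- Geometric series for `(w Z)^k` with a unimodular `w`: `HasSum (fun k => (w^k Z^k)) (1−wZ)⁻¹` and
norm-summability. [folklore] -/
private theorem hasSum_geom_unimod {w Z : ℂ} (hw : ‖w‖ = 1) (hZ : ‖Z‖ < 1) :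
    HasSum (fun k : ℕ => w ^ k * Z ^ k) (1 - w * Z)⁻¹ ∧
      Summable (fun k : ℕ => ‖w ^ k * Z ^ k‖) := by
  have hwZ : ‖w * Z‖ < 1 := by rw [norm_mul, hw, one_mul]; exact hZ
  refine ⟨?_, ?_⟩
  · have h := hasSum_geometric_of_norm_lt_one hwZ
    simp only [mul_pow] at h
    exact h
  · have h := (summable_geometric_of_lt_one (norm_nonneg _) hwZ)
    refine h.congr (fun k => ?_)
    rw [norm_mul, norm_mul, norm_pow, norm_pow, mul_pow]

/-- **The generating function of `κ` at a prime `q`**: for `|Z| < 1`,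
`Σ_{r≥0} κ(q^r)Z^r = (1 − Z)/((1 − q^{−ib₁}Z)(1 − q^{−ib₂}Z)(1 − q^{−ib₃}Z))`, i.e. the local factor of
`ζ(s+β₁)ζ(s+β₂)ζ(s+β₃)/ζ(s)` with `Z = q^{−s}` (`κ = n^{−ib₁} ∗ n^{−ib₂} ∗ n^{−ib₃} ∗ μ`; two Cauchy
products of geometric series and `κ(q^{r+1}) = c(q^{r+1}) − c(q^r)`). [cite: Zhang2022LandauSiegel, §7 p. 33] -/
theorem hasSum_kappa_prime_pow_mul_pow (b₁ b₂ b₃ : ℝ) {q : ℕ} (hq : q.Prime) {Z : ℂ} (hZ : ‖Z‖ < 1) :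
    HasSum (fun r : ℕ => kappa b₁ b₂ b₃ (q ^ r) * Z ^ r)
      ((1 - Z) / ((1 - powI b₁ q * Z) * (1 - powI b₂ q * Z) * (1 - powI b₃ q * Z))) := by
  set w₁ : ℂ := powI b₁ q with hw₁
  set w₂ : ℂ := powI b₂ q with hw₂
  set w₃ : ℂ := powI b₃ q with hw₃
  have n₁ : ‖w₁‖ = 1 := norm_powI_eq_one b₁ hq.pos
  have n₂ : ‖w₂‖ = 1 := norm_powI_eq_one b₂ hq.pos
  have n₃ : ‖w₃‖ = 1 := norm_powI_eq_one b₃ hq.pos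
  have hne : ∀ {w : ℂ}, ‖w‖ = 1 → 1 - w * Z ≠ 0 := fun {w} hw h0 => by
    have : ‖w * Z‖ = 1 := by rw [← sub_eq_zero.mp h0, norm_one]
    rw [norm_mul, hw, one_mul] at this
    rw [this] at hZ; exact lt_irrefl _ hZ
  obtain ⟨g₁, s₁⟩ := hasSum_geom_unimod n₁ hZ
  obtain ⟨g₂, s₂⟩ := hasSum_geom_unimod n₂ hZ
  obtain ⟨g₃, s₃⟩ := hasSum_geom_unimod n₃ hZ
  -- Step 1: `c₁₂(q^n) Z^n` as a Cauchy product
  have hc12 : ∀ n : ℕ, (powI b₁ * powI b₂) (q ^ n) * Z ^ n =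
      ∑ k ∈ range (n + 1), (w₁ ^ k * Z ^ k) * (w₂ ^ (n - k) * Z ^ (n - k)) := fun n => by
    rw [c12_prime_pow b₁ b₂ hq n, Finset.sum_mul]
    refine Finset.sum_congr rfl fun k hk => ?_
    have hkn : k ≤ n := Nat.lt_succ_iff.mp (Finset.mem_range.mp hk)
    rw [powI_prime_pow_eq_pow b₁ hq.pos, powI_prime_pow_eq_pow b₂ hq.pos, ← hw₁, ← hw₂]
    have : Z ^ n = Z ^ k * Z ^ (n - k) := by rw [← pow_add, Nat.add_sub_cancel' hkn]
    rw [this]; ring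
  have H12 : HasSum (fun n : ℕ => (powI b₁ * powI b₂) (q ^ n) * Z ^ n)
      ((1 - w₁ * Z)⁻¹ * (1 - w₂ * Z)⁻¹) := by
    have h := hasSum_sum_range_mul_of_summable_norm s₁ s₂
    rw [g₁.tsum_eq, g₂.tsum_eq] at h
    rw [show (fun n : ℕ => (powI b₁ * powI b₂) (q ^ n) * Z ^ n) =
        fun n => ∑ k ∈ range (n + 1), (w₁ ^ k * Z ^ k) * (w₂ ^ (n - k) * Z ^ (n - k)) from funext hc12]
    exact h
  have S12 : Summable (fun n : ℕ => ‖(powI b₁ * powI b₂) (q ^ n) * Z ^ n‖) := by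
    have h := summable_norm_sum_mul_range_of_summable_norm s₁ s₂
    exact h.congr (fun n => by rw [hc12 n])
  -- Step 2: `c(q^n) Z^n` as a Cauchy product
  have hc123 : ∀ n : ℕ, (powI b₁ * powI b₂ * powI b₃) (q ^ n) * Z ^ n =
      ∑ k ∈ range (n + 1), ((powI b₁ * powI b₂) (q ^ k) * Z ^ k) * (w₃ ^ (n - k) * Z ^ (n - k)) :=
    fun n => by
    rw [c123_prime_pow b₁ b₂ b₃ hq n, Finset.sum_mul]
    refine Finset.sum_congr rfl fun k hk => ?_
    have hkn : k ≤ n := Nat.lt_succ_iff.mp (Finset.mem_range.mp hk)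
    rw [powI_prime_pow_eq_pow b₃ hq.pos, ← hw₃]
    have : Z ^ n = Z ^ k * Z ^ (n - k) := by rw [← pow_add, Nat.add_sub_cancel' hkn]
    rw [this]; ring
  have H123 : HasSum (fun n : ℕ => (powI b₁ * powI b₂ * powI b₃) (q ^ n) * Z ^ n)
      ((1 - w₁ * Z)⁻¹ * (1 - w₂ * Z)⁻¹ * (1 - w₃ * Z)⁻¹) := by
    have h := hasSum_sum_range_mul_of_summable_norm S12 s₃
    rw [H12.tsum_eq, g₃.tsum_eq] at h
    rw [show (fun n : ℕ => (powI b₁ * powI b₂ * powI b₃) (q ^ n) * Z ^ n) =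
        fun n => ∑ k ∈ range (n + 1), ((powI b₁ * powI b₂) (q ^ k) * Z ^ k) * (w₃ ^ (n - k) * Z ^ (n - k))
        from funext hc123]
    exact h
  -- Step 3: `κ(q^{r+1}) Z^{r+1} = c(q^{r+1})Z^{r+1} − Z·c(q^r)Z^r`
  set V : ℂ := (1 - w₁ * Z)⁻¹ * (1 - w₂ * Z)⁻¹ * (1 - w₃ * Z)⁻¹ with hV
  have hc1 : (powI b₁ * powI b₂ * powI b₃) 1 = 1 :=
    ((((isMultiplicative_powI b₁).mul (isMultiplicative_powI b₂)).mul
      (isMultiplicative_powI b₃))).map_one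
  have Hshift : HasSum (fun r : ℕ => (powI b₁ * powI b₂ * powI b₃) (q ^ (r + 1)) * Z ^ (r + 1))
      (V - 1) := by
    have h := (hasSum_nat_add_iff' 1).mpr H123
    simp only [Finset.range_one, Finset.sum_singleton, pow_zero, mul_one, hc1] at h
    exact h
  have HZ : HasSum (fun r : ℕ => Z * ((powI b₁ * powI b₂ * powI b₃) (q ^ r) * Z ^ r)) (Z * V) :=
    H123.mul_left Z
  have Hk : HasSum (fun r : ℕ => kappa b₁ b₂ b₃ (q ^ (r + 1)) * Z ^ (r + 1)) ((V - 1) - Z * V) := by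
    have h := Hshift.sub HZ
    have hfg : (fun r : ℕ => kappa b₁ b₂ b₃ (q ^ (r + 1)) * Z ^ (r + 1)) =
        fun r => (powI b₁ * powI b₂ * powI b₃) (q ^ (r + 1)) * Z ^ (r + 1) -
          Z * ((powI b₁ * powI b₂ * powI b₃) (q ^ r) * Z ^ r) := by
      funext r; rw [kappa_prime_pow_succ b₁ b₂ b₃ hq r]; ring
    rw [hfg]; exact h
  have H : HasSum (fun r : ℕ => kappa b₁ b₂ b₃ (q ^ r) * Z ^ r) ((1 - Z) * V) := by
    refine (hasSum_nat_add_iff' 1).mp ?_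
    simp only [Finset.range_one, Finset.sum_singleton, pow_zero, mul_one,
      (isMultiplicative_kappa b₁ b₂ b₃).map_one]
    have e : (1 - Z) * V - 1 = (V - 1) - Z * V := by ring
    rw [e]; exact Hk
  have e : (1 - Z) * V = (1 - Z) / ((1 - w₁ * Z) * (1 - w₂ * Z) * (1 - w₃ * Z)) := by
    rw [hV]; field_simp [hne n₁, hne n₂, hne n₃]
  rw [← e]; exact H

/-! ## The shifts as `powI`, and the three factors of `pref` -/

/-- `q^{−β_k} = q^{−ib_k}` (`β_k = ib_k`): `(q:ℂ)^(−β₁) = powI b₁ q` etc.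
[cite: Zhang2022LandauSiegel, §2 (2.13)] -/
theorem cpow_neg_beta_eq_powI (c' : ℝ) (D : ℕ) {q : ℕ} (hq : 0 < q) :
    (q : ℂ) ^ (-beta1 c' D) = powI (b1 c' D) q ∧ (q : ℂ) ^ (-beta2 c' D) = powI (b2 c' D) q ∧
      (q : ℂ) ^ (-beta3 c' D) = powI (b3 c' D) q := by
  have e1 : beta1 c' D = (b1 c' D : ℂ) * I := by rw [beta1, b1]; push_cast; ring
  have e2 : beta2 c' D = (b2 c' D : ℂ) * I := by rw [beta2, b2]; push_cast; ring
  have e3 : beta3 c' D = (b3 c' D : ℂ) * I := by rw [beta3, b3]; push_cast; ring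
  refine ⟨?_, ?_, ?_⟩
  · rw [powI_apply_of_ne_zero _ hq.ne', e1]
  · rw [powI_apply_of_ne_zero _ hq.ne', e2]
  · rw [powI_apply_of_ne_zero _ hq.ne', e3]

/-- For `j ∈ {1,2,3}`, the three shifts `β_{j+1}, β_{j+2}, β_j` are `β₁, β₂, β₃` in some order, so
`(1−aq^{−β_{j+1}})(1−aq^{−β_{j+2}})(1−aq^{−β_j}) = (1−aq^{−β₁})(1−aq^{−β₂})(1−aq^{−β₃})`.
[cite: Zhang2022LandauSiegel, §8 p. 17] -/
theorem prod_three_shifts (c' : ℝ) (D : ℕ) {j : ℕ} (hj : j ∈ ({1, 2, 3} : Finset ℕ)) (a q : ℂ) :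
    (1 - a * q ^ (-betaJ c' D (j + 1))) * (1 - a * q ^ (-betaJ c' D (j + 2))) *
        (1 - a * q ^ (-betaJ c' D j)) =
      (1 - a * q ^ (-beta1 c' D)) * (1 - a * q ^ (-beta2 c' D)) * (1 - a * q ^ (-beta3 c' D)) := by
  simp only [Finset.mem_insert, Finset.mem_singleton] at hj
  rcases hj with rfl | rfl | rfl
  · simp only [betaJ, Nat.reduceMod, Nat.reduceAdd, if_true]; norm_num; ring
  · simp only [betaJ, Nat.reduceMod, Nat.reduceAdd]; norm_num; ring
  · simp only [betaJ, Nat.reduceMod, Nat.reduceAdd]; norm_num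

/-! ## Cases 2 and 3 in closed form -/

/-- The common computation: for `|X| < 1`, `v = χ(q)` and the relevant Euler data,
`pref·Σ_{r≥0} κ(q^r)(vX)^r = 1/(1 − vX q^{−β_j})`. [cite: Zhang2022LandauSiegel, App. A p. 102] -/
theorem pref_mul_kappaGen (c' : ℝ) {D : ℕ} (χ : DirichletCharacter ℂ D) {j : ℕ}
    (hj : j ∈ ({1, 2, 3} : Finset ℕ)) {q : ℕ} (hq : q.Prime) (s : ℂ) (hs : 0 < s.re) :
    let X : ℂ := (q : ℂ) ^ (-s)
    let v : ℂ := χ (q : ZMod D)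
    HasSum (fun r : ℕ => kappaZ c' D (q ^ r) * (v * X) ^ r)
        ((1 - v * X) / ((1 - v * X * (q : ℂ) ^ (-beta1 c' D)) * (1 - v * X * (q : ℂ) ^ (-beta2 c' D)) *
          (1 - v * X * (q : ℂ) ^ (-beta3 c' D)))) ∧
      pref c' χ j s q * ((1 - v * X) / ((1 - v * X * (q : ℂ) ^ (-beta1 c' D)) *
          (1 - v * X * (q : ℂ) ^ (-beta2 c' D)) * (1 - v * X * (q : ℂ) ^ (-beta3 c' D)))) =
        1 / (1 - v * X * (q : ℂ) ^ (-betaJ c' D j)) := by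
  intro X v
  have hq0 : (q : ℂ) ≠ 0 := by exact_mod_cast hq.ne_zero
  have hXn : ‖X‖ < 1 := by
    show ‖(q : ℂ) ^ (-s)‖ < 1
    rw [Complex.norm_natCast_cpow_of_pos hq.pos, Complex.neg_re]
    exact Real.rpow_lt_one_of_one_lt_of_neg (by exact_mod_cast hq.one_lt) (by linarith)
  have hvn : ‖v‖ ≤ 1 := χ.norm_le_one _
  have hvX : ‖v * X‖ < 1 := by
    rw [norm_mul]; nlinarith [norm_nonneg v, norm_nonneg X]
  obtain ⟨e1, e2, e3⟩ := cpow_neg_beta_eq_powI c' D hq.pos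
  have hgen := hasSum_kappa_prime_pow_mul_pow (b1 c' D) (b2 c' D) (b3 c' D) hq hvX
  rw [← e1, ← e2, ← e3] at hgen
  refine ⟨?_, ?_⟩
  · rw [show (1 - v * X) / ((1 - v * X * (q : ℂ) ^ (-beta1 c' D)) * (1 - v * X * (q : ℂ) ^ (-beta2 c' D)) *
          (1 - v * X * (q : ℂ) ^ (-beta3 c' D))) =
        (1 - v * X) / ((1 - (q : ℂ) ^ (-beta1 c' D) * (v * X)) * (1 - (q : ℂ) ^ (-beta2 c' D) * (v * X)) *
          (1 - (q : ℂ) ^ (-beta3 c' D) * (v * X))) by ring]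
    simpa only [kappaZ] using hgen
  -- nonvanishing of the unimodular-twisted denominators
  have hre : ∀ k, (-betaJ c' D k).re = 0 := fun k => by
    rw [Complex.neg_re]; unfold betaJ beta1 beta2 beta3; split_ifs <;> simp
  have hwn : ∀ k, ‖(q : ℂ) ^ (-betaJ c' D k)‖ = 1 := fun k => by
    rw [Complex.norm_natCast_cpow_of_pos hq.pos, hre k, Real.rpow_zero]
  have hne : ∀ k, 1 - v * X * (q : ℂ) ^ (-betaJ c' D k) ≠ 0 := fun k h0 => by
    have : ‖v * X * (q : ℂ) ^ (-betaJ c' D k)‖ = 1 := by rw [← sub_eq_zero.mp h0, norm_one]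
    rw [norm_mul, hwn k, mul_one] at this
    rw [this] at hvX; exact lt_irrefl _ hvX
  have hne0 : 1 - v * X ≠ 0 := fun h0 => by
    have : ‖v * X‖ = 1 := by rw [← sub_eq_zero.mp h0, norm_one]
    rw [this] at hvX; exact lt_irrefl _ hvX
  have h1 := hne (j + 1); have h2 := hne (j + 2); have h3 := hne j
  -- `pref` with `q^{-(s+β)} = X·q^{-β}`
  have hpref : pref c' χ j s q =
      (1 - v * X * (q : ℂ) ^ (-betaJ c' D (j + 1))) * (1 - v * X * (q : ℂ) ^ (-betaJ c' D (j + 2))) /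
        (1 - v * X) := by
    unfold pref
    rw [neg_add, Complex.cpow_add _ _ hq0, neg_add, Complex.cpow_add _ _ hq0]
    ring
  rw [hpref, ← prod_three_shifts c' D hj (v * X) (q : ℂ)]
  field_simp

/-- **Case 2 in closed form** (`q ∣ h`): `𝔱_j(d,h,s;q) = 1/(1 − χ(q)q^{−s}q^{−β_j})` for `σ > 0`
(`ξ_j(q^r;d,h) = κ(q^r)`, `λ̃(q,dh;1−β_j) = 1`, and the generating function of `κ`).
[cite: Zhang2022LandauSiegel, App. A p. 102] -/
theorem frakt_eq_of_dvd_right (c' : ℝ) {D : ℕ} (χ : DirichletCharacter ℂ D) {j : ℕ}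
    (hj : j ∈ ({1, 2, 3} : Finset ℕ)) {d h q : ℕ} (hd : 1 ≤ d) (hh : 1 ≤ h) (hq : q.Prime)
    (hqh : q ∣ h) (s : ℂ) (hs : 0 < s.re) :
    frakt c' χ j d h s q = 1 / (1 - χ (q : ZMod D) * (q : ℂ) ^ (-s) * (q : ℂ) ^ (-betaJ c' D j)) := by
  obtain ⟨hgen, hprod⟩ := pref_mul_kappaGen c' χ hj hq s hs
  set X : ℂ := (q : ℂ) ^ (-s) with hX
  set v : ℂ := χ (q : ZMod D) with hv
  have hlam : lamTilde c' D q (d * h) (1 - betaJ c' D j) = 1 :=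
    stepA_u017_lamTilde_holds c' D j d h q hd hq hqh
  have hxi : ∀ r : ℕ, xiA c' D j (q ^ (r + 1)) d h = kappaZ c' D (q ^ (r + 1)) := fun r =>
    stepA_u016_eq_holds c' D j d h q (r + 1) hd hh hq hqh (by omega)
  -- `1 + xiPowSum = Σ_{r≥0} κ(q^r)(vX)^r`
  set G : ℂ := (1 - v * X) / ((1 - v * X * (q : ℂ) ^ (-beta1 c' D)) *
    (1 - v * X * (q : ℂ) ^ (-beta2 c' D)) * (1 - v * X * (q : ℂ) ^ (-beta3 c' D))) with hG
  have hsum : 1 + xiPowSum c' χ j d h s q = G := by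
    rw [xiPowSum_eq c' χ j d h s hq.pos]
    have hg := (hasSum_nat_add_iff' 1).mpr hgen
    simp only [Finset.range_one, Finset.sum_singleton, pow_zero, mul_one, kappaZ_one] at hg
    have hfg : (fun r : ℕ => (v * X) ^ (r + 1) * xiA c' D j (q ^ (r + 1)) d h) =
        fun r => kappaZ c' D (q ^ (r + 1)) * (v * X) ^ (r + 1) := by
      funext r; rw [hxi r]; ring
    rw [hfg, hg.tsum_eq]; ring
  unfold frakt
  rw [hlam, one_mul, hsum, hprod]

/-- **Case 3 in closed form** (`q ∣ d`, `(q,h) = 1`):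
`𝔱_j(d,h,s;q) = (1 − c₀χ(q)q^{−s}q^{−β_j})/(1 − χ(q)q^{−s}q^{−β_j})` with `c₀ = q/(q−1)`, for `σ > 0`
(`ξ_j(q^r;d,h) = κ(q^r) − κ(q^{r−1})q^{1−β_j}/(q−1)`). [cite: Zhang2022LandauSiegel, App. A p. 103] -/
theorem frakt_eq_of_dvd_left (c' : ℝ) {D : ℕ} (χ : DirichletCharacter ℂ D) {j : ℕ}
    (hj : j ∈ ({1, 2, 3} : Finset ℕ)) {d h q : ℕ} (hd : 1 ≤ d) (hh : 1 ≤ h) (hq : q.Prime)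
    (hqd : q ∣ d) (hqh : ¬ q ∣ h) (s : ℂ) (hs : 0 < s.re) :
    frakt c' χ j d h s q =
      (1 - ((q : ℂ) / ((q : ℂ) - 1)) * (χ (q : ZMod D) * (q : ℂ) ^ (-s) * (q : ℂ) ^ (-betaJ c' D j))) /
        (1 - χ (q : ZMod D) * (q : ℂ) ^ (-s) * (q : ℂ) ^ (-betaJ c' D j)) := by
  obtain ⟨hgen, hprod⟩ := pref_mul_kappaGen c' χ hj hq s hs
  set X : ℂ := (q : ℂ) ^ (-s) with hX
  set v : ℂ := χ (q : ZMod D) with hv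
  have hq0 : (q : ℂ) ≠ 0 := by exact_mod_cast hq.ne_zero
  have hlam : lamTilde c' D q (d * h) (1 - betaJ c' D j) = 1 :=
    stepA_u018_lamTilde_holds c' D j d h q hh hq hqd
  set w : ℂ := (q : ℂ) ^ (-betaJ c' D j) with hw
  set c₀ : ℂ := (q : ℂ) / ((q : ℂ) - 1) with hc₀
  have hfrac : (q : ℂ) ^ (1 - betaJ c' D j) / ((q : ℂ) - 1) = c₀ * w := by
    rw [sub_eq_add_neg (1 : ℂ), Complex.cpow_add _ _ hq0, Complex.cpow_one, hc₀, hw]; ring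
  have hxi : ∀ r : ℕ, xiA c' D j (q ^ (r + 1)) d h =
      kappaZ c' D (q ^ (r + 1)) - c₀ * w * kappaZ c' D (q ^ r) := fun r => by
    rw [stepA_u018_eq_corrected c' D j d h q (r + 1) hd hh hq hqd
      ((Nat.Prime.coprime_iff_not_dvd hq).mpr hqh) (by omega), Nat.add_sub_cancel, mul_div_assoc, hfrac]
    ring
  set G : ℂ := (1 - v * X) / ((1 - v * X * (q : ℂ) ^ (-beta1 c' D)) *
    (1 - v * X * (q : ℂ) ^ (-beta2 c' D)) * (1 - v * X * (q : ℂ) ^ (-beta3 c' D))) with hG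
  -- `Σ_{r≥0} (vX)^{r+1} κ(q^{r+1}) = G − 1` and `Σ_{r≥0} (vX)^{r+1} κ(q^r) = vX·G`
  have hA : HasSum (fun r : ℕ => (v * X) ^ (r + 1) * kappaZ c' D (q ^ (r + 1))) (G - 1) := by
    have hg := (hasSum_nat_add_iff' 1).mpr hgen
    simp only [Finset.range_one, Finset.sum_singleton, pow_zero, mul_one, kappaZ_one] at hg
    have hfg : (fun r : ℕ => (v * X) ^ (r + 1) * kappaZ c' D (q ^ (r + 1))) =
        fun r => kappaZ c' D (q ^ (r + 1)) * (v * X) ^ (r + 1) := by funext r; ring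
    rw [hfg]; exact hg
  have hB : HasSum (fun r : ℕ => (v * X) ^ (r + 1) * kappaZ c' D (q ^ r)) (v * X * G) := by
    have hg := hgen.mul_left (v * X)
    have hfg : (fun r : ℕ => (v * X) ^ (r + 1) * kappaZ c' D (q ^ r)) =
        fun r => v * X * (kappaZ c' D (q ^ r) * (v * X) ^ r) := by funext r; ring
    rw [hfg]; exact hg
  have hsum : xiPowSum c' χ j d h s q = (G - 1) - c₀ * w * (v * X * G) := by
    rw [xiPowSum_eq c' χ j d h s hq.pos]
    have hg := hA.sub (hB.mul_left (c₀ * w))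
    rw [← hg.tsum_eq]
    exact tsum_congr fun r => by rw [hxi r]; ring
  unfold frakt
  rw [hlam, one_mul, hsum]
  have e : pref c' χ j s q * (1 + (G - 1 - c₀ * w * (v * X * G))) =
      (1 - c₀ * (v * X * w)) * (pref c' χ j s q * G) := by ring
  rw [e, hprod]
  ring

/-- `2^{−1/2} ≤ 71/100` (`√2 > 1.41`). [folklore] -/
private theorem two_rpow_neg_half_le : (2 : ℝ) ^ (-(1 / 2 : ℝ)) ≤ 71 / 100 := by
  rw [Real.rpow_neg (by norm_num), ← Real.sqrt_eq_rpow]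
  have h : (141 / 100 : ℝ) < Real.sqrt 2 := by
    rw [Real.lt_sqrt (by norm_num)]; norm_num
  rw [inv_le_comm₀ (by positivity) (by norm_num)]
  linarith

/-- For `σ > 9/10` and a prime `q`: `q^{−σ} ≤ 71/100`. [folklore] -/
private theorem rpow_neg_re_le {q : ℕ} (hq : q.Prime) {s : ℂ} (hs : 9 / 10 < s.re) :
    (q : ℝ) ^ (-s.re) ≤ 71 / 100 := by
  have hq2 : (2 : ℝ) ≤ q := by exact_mod_cast hq.two_le
  calc (q : ℝ) ^ (-s.re) ≤ (q : ℝ) ^ (-(1 / 2 : ℝ)) :=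
        Real.rpow_le_rpow_of_exponent_le (by linarith) (by linarith)
    _ ≤ (2 : ℝ) ^ (-(1 / 2 : ℝ)) :=
        Real.rpow_le_rpow_of_nonpos (by norm_num) hq2 (by norm_num)
    _ ≤ 71 / 100 := two_rpow_neg_half_le

/-- `‖1/(1 − a)‖ ≤ 1 + 4x` when `‖a‖ ≤ x ≤ 71/100`. [folklore] -/
private theorem norm_one_div_one_sub_le {a : ℂ} {x : ℝ} (ha : ‖a‖ ≤ x) (hx : x ≤ 71 / 100) :
    ‖1 / (1 - a)‖ ≤ 1 + 4 * x := by
  have hx0 : 0 ≤ x := le_trans (norm_nonneg _) ha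
  have hden : 1 - x ≤ ‖1 - a‖ := by
    linarith [norm_le_norm_add_norm_sub' (1 : ℂ) a, norm_one (α := ℂ)]
  have hpos : 0 < 1 - x := by linarith
  rw [norm_div, norm_one, div_le_iff₀ (lt_of_lt_of_le hpos hden)]
  nlinarith [mul_le_mul_of_nonneg_left hden (by linarith : (0:ℝ) ≤ 1 + 4 * x)]

/-- **The local bound at the primes dividing `dh`** (GAP-LEDGER G-d55-2; Lemma 8.3 (ii)'s input, not in
print): for a prime `q ∣ dh`, `1 ≤ j ≤ 3` and `σ > 9/10`, `‖𝔱_j(d,h,s;q)‖ ≤ 1 + 12q^{−σ}` (any `D`, any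
Dirichlet character; from the closed forms, `|χ(q)q^{−s}q^{−β}| ≤ q^{−σ} ≤ 2^{−1/2} < 0.71`).
[cite: Zhang2022LandauSiegel, §8 Lemma 8.3] -/
theorem norm_frakt_le_of_dvd (c' : ℝ) {D : ℕ} (χ : DirichletCharacter ℂ D) {j : ℕ}
    (hj : j ∈ ({1, 2, 3} : Finset ℕ)) {d h q : ℕ} (hd : 1 ≤ d) (hh : 1 ≤ h) (hq : q.Prime)
    (hqdh : q ∣ d * h) (s : ℂ) (hs : 9 / 10 < s.re) :
    ‖frakt c' χ j d h s q‖ ≤ 1 + 12 * (q : ℝ) ^ (-s.re) := by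
  have hs0 : 0 < s.re := by linarith
  set X : ℂ := (q : ℂ) ^ (-s) with hX
  set v : ℂ := χ (q : ZMod D) with hv
  set w : ℂ := (q : ℂ) ^ (-betaJ c' D j) with hw
  set x : ℝ := (q : ℝ) ^ (-s.re) with hxdef
  have hx : x ≤ 71 / 100 := rpow_neg_re_le hq hs
  have hx0 : 0 ≤ x := by positivity
  have hXn : ‖X‖ = x := by
    rw [hX, Complex.norm_natCast_cpow_of_pos hq.pos, Complex.neg_re]
  have hvn : ‖v‖ ≤ 1 := χ.norm_le_one _
  have hwn : ‖w‖ = 1 := by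
    rw [hw, Complex.norm_natCast_cpow_of_pos hq.pos]
    have : (-betaJ c' D j).re = 0 := by
      rw [Complex.neg_re]; unfold betaJ beta1 beta2 beta3; split_ifs <;> simp
    rw [this, Real.rpow_zero]
  have ha : ‖v * X * w‖ ≤ x := by
    rw [norm_mul, norm_mul, hwn, hXn, mul_one]; nlinarith [norm_nonneg v]
  have hinv : ‖1 / (1 - v * X * w)‖ ≤ 1 + 4 * x := norm_one_div_one_sub_le ha hx
  rcases (Nat.Prime.dvd_mul hq).mp hqdh with hqd | hqh
  · by_cases hqh : q ∣ h
    · rw [frakt_eq_of_dvd_right c' χ hj hd hh hq hqh s hs0]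
      linarith
    · rw [frakt_eq_of_dvd_left c' χ hj hd hh hq hqd hqh s hs0]
      have hq2 : (2 : ℝ) ≤ q := by exact_mod_cast hq.two_le
      have hc₀ : ‖(q : ℂ) / ((q : ℂ) - 1)‖ ≤ 2 := by
        have h1 : ‖(q : ℂ) - 1‖ = (q : ℝ) - 1 := by
          rw [show (q : ℂ) - 1 = (((q : ℝ) - 1 : ℝ) : ℂ) by push_cast; ring, Complex.norm_real,
            Real.norm_eq_abs, abs_of_nonneg (by linarith)]
        rw [norm_div, Complex.norm_natCast, h1, div_le_iff₀ (by linarith)]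
        linarith
      have hnum : ‖1 - (q : ℂ) / ((q : ℂ) - 1) * (v * X * w)‖ ≤ 1 + 2 * x := by
        calc _ ≤ ‖(1 : ℂ)‖ + ‖(q : ℂ) / ((q : ℂ) - 1) * (v * X * w)‖ := norm_sub_le _ _
          _ ≤ 1 + 2 * x := by
              rw [norm_one, norm_mul]
              exact add_le_add le_rfl (mul_le_mul hc₀ ha (norm_nonneg _) (by norm_num))
      rw [div_eq_mul_one_div, norm_mul]
      calc ‖1 - (q : ℂ) / ((q : ℂ) - 1) * (v * X * w)‖ * ‖1 / (1 - v * X * w)‖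
          ≤ (1 + 2 * x) * (1 + 4 * x) := mul_le_mul hnum hinv (norm_nonneg _) (by positivity)
        _ = 1 + 6 * x + 8 * x * x := by ring
        _ ≤ 1 + 12 * x := by nlinarith
  · rw [frakt_eq_of_dvd_right c' χ hj hd hh hq hqh s hs0]
    linarith

/-- **GAP-LEDGER G-d55-2's wanted statement, PROVED** (in the campaign's `ForAllLarge` frame, with
the row's hypotheses; Assumption (A), `dh < PT⁻²` and `q ∤ D` are carried but not used):
for `q ∣ dh`, `σ > 9/10`: `‖𝔱_j(d,h,s;q)‖ ≤ 1 + 12·q^{−σ}`. [cite: Zhang2022LandauSiegel, §8 Lemma 8.3] -/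
theorem stepA_u007_dvd (c' : ℝ) :
    ∃ c : ℝ, ForAllLarge fun D _ χ => AssumptionA D χ → ∀ j ∈ ({1, 2, 3} : Finset ℕ), ∀ d h : ℕ,
      1 ≤ d → 1 ≤ h → ((d * h : ℕ) : ℝ) < bigP D / bigT D ^ 2 → ∀ q : ℕ, q.Prime → q ∣ d * h →
        ¬ q ∣ D → ∀ s : ℂ, 9 / 10 < s.re →
          ‖frakt c' χ j d h s q‖ ≤ 1 + c * (q : ℝ) ^ (-s.re) :=
  ⟨12, 0, fun _ _ χ _ _ _ _ _ hj _ _ hd hh _ _ hq hqdh _ s hs =>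
    norm_frakt_le_of_dvd c' χ hj hd hh hq hqdh s hs⟩

end Literature.NumberTheory.LFunctions.Zhang2022.Lemma83
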